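import Summits.ResolutionOfSingularities.ResolutionOfSingularities.Theorems.ValuativeLuAlphaPTorsorDimTwoTransport
import Literature.AlgebraicGeometry.Resolution.LocalBlowupModels

/-!
# Finitely generated models of the members of the pulled-back quadratic sequence

Helper file for the stub `exists_model_of_sequence_member` (bookkeeping step KM) of the line
`pfaff-line-log-final-forms` (crux `Valuative.LuAlphaPTorsor`,
item `stmt-ResolutionOfSingularities-0641`).

Setting: `K/k` fields, `O` a valuation ring of `K`, `ι : K' →+* K` a field embedding,
`A₀ ⊆ O` a finitely generated `k`-subalgebra of `K` contained in `range ι`. The Giraud induction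
of the line runs along an infinite sequence `R : ℕ → Subring K'` of quadratic transforms along
the pulled-back valuation ring `O' = O.comap ι`, starting at the local ring
`R 0 = (A₀')_{𝔪_{O'} ∩ A₀'}` of the pulled-back base `A₀' = A₀.comap ι` — while richness of
derivations, presentations and the final conclusion of the line live on
`Localization.AtPrime (𝔪_O ∩ A₁)` for finitely generated models `A₁ ⊆ K`. This file bridges the
two worlds, all [folklore]:

* `map_closure_comap_union`, `comap_closure_union_image` — for `B ≤ range ι` and `s ⊆ K'`,
  `ι (B.comap ι [s]) = B[ι s]` and `(B[ι s]).comap ι = (B.comap ι)[s]`;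
* `exists_model_of_sequence_member` — every member `R n` is the pull-back along `ι` of the local
  ring `(A₁)_{𝔪_O ∩ A₁}` of a finitely generated model `A₀ ≤ A₁ ⊆ O`, `A₁ ≤ range ι`, and is
  ring-isomorphic to `Localization.AtPrime (𝔪_O ∩ A₁)` compatibly with the structure map.
-/

set_option linter.dupNamespace false

namespace Summit.ResolutionOfSingularities.ResolutionOfSingularities.Theorems.PfaffLine

open IsLocalRing Literature.AlgebraicGeometry.Resolution

section closures

variable {K K' : Type} [Field K] [Field K']

/-- For `B ≤ range ι` and `s ⊆ K'`: the image along `ι` of the subring generated by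
`B.comap ι ∪ s` is the subring generated by `B ∪ ι '' s`. [folklore] -/
theorem map_closure_comap_union (ι : K' →+* K) {B : Subring K} (hB : B ≤ ι.range) (s : Set K') :
    (Subring.closure ((B.comap ι : Set K') ∪ s)).map ι = Subring.closure ((B : Set K) ∪ ι '' s) := by
  have hB' : (B : Set K) ⊆ Set.range ι := fun x hx => hB hx
  rw [RingHom.map_closure, Set.image_union, Subring.coe_comap, Set.image_preimage_eq_of_subset hB']

/-- For `B ≤ range ι` and `s ⊆ K'`: the pull-back along `ι` of the subring generated by
`B ∪ ι '' s` is the subring generated by `B.comap ι ∪ s` (`ι` is injective). [folklore] -/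
theorem comap_closure_union_image (ι : K' →+* K) {B : Subring K} (hB : B ≤ ι.range) (s : Set K') :
    (Subring.closure ((B : Set K) ∪ ι '' s)).comap ι = Subring.closure ((B.comap ι : Set K') ∪ s) := by
  rw [← map_closure_comap_union ι hB s, Subring.comap_map_eq_self_of_injective ι.injective]

/-- The subring generated by `B ∪ ι '' s` lies in `range ι` when `B` does. [folklore] -/
theorem closure_union_image_le_range (ι : K' →+* K) {B : Subring K} (hB : B ≤ ι.range)
    (s : Set K') : Subring.closure ((B : Set K) ∪ ι '' s) ≤ ι.range := by
  refine Subring.closure_le.mpr (Set.union_subset hB ?_)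
  rintro _ ⟨y, -, rfl⟩
  exact ⟨y, rfl⟩

/-- The subring generated by `B ∪ ι '' s` lies in `O` when `B ≤ O` and `s ⊆ O.comap ι`.
[folklore] -/
theorem closure_union_image_le_valuationSubring (ι : K' →+* K) (O : ValuationSubring K)
    {B : Subring K} (hB : B ≤ O.toSubring) {s : Set K'} (hs : s ⊆ O.comap ι) :
    Subring.closure ((B : Set K) ∪ ι '' s) ≤ O.toSubring := by
  refine Subring.closure_le.mpr (Set.union_subset hB ?_)
  rintro _ ⟨y, hy, rfl⟩
  exact hs hy

end closures

section model

/-- **Every member of the pulled-back quadratic sequence is the local ring of a finitely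
generated model.** For a finitely generated `k`-subalgebra `A₀ ⊆ O` of `K` inside the range of a
field embedding `ι : K' →+* K`, and a sequence `R : ℕ → Subring K'` of quadratic transforms
along `O.comap ι` starting at the local ring of `A₀.comap ι` at the centre of `O.comap ι`: every
member `R n` is the pull-back along `ι` of `(A₁)_{𝔪_O ∩ A₁}` for a finitely generated
`k`-subalgebra `A₀ ≤ A₁ ⊆ O` with `A₁ ≤ range ι` (namely `A₁ = A₀[ι t]` for the finite
`t ⊆ O.comap ι` of `exists_eq_locAtCentre_closure_of_sequence`), and `R n` is ring-isomorphic
to `Localization.AtPrime (𝔪_O ∩ A₁)` compatibly with the structure map on the elements of `A₁`.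
[folklore] -/
theorem exists_model_of_sequence_member : ∀ (k K K' : Type) [Field k] [Field K] [Algebra k K] [Field K'] (ι : K' →+* K) (O : ValuationSubring K) (A₀ : Subalgebra k K) (h₀ : A₀.toSubring ≤ O.toSubring), A₀.FG → A₀.toSubring ≤ ι.range → ∀ (R : ℕ → Subring K'), R 0 = Literature.AlgebraicGeometry.Resolution.locAtCentre (A₀.toSubring.comap ι) (O.comap ι) → (∀ i, Literature.AlgebraicGeometry.Resolution.IsQuadraticTransformAlong (O.comap ι) (R i) (R (i + 1))) → ∀ (n : ℕ), ∃ (A₁ : Subalgebra k K) (h₁ : A₁.toSubring ≤ O.toSubring), A₀ ≤ A₁ ∧ A₁.FG ∧ A₁.toSubring ≤ ι.range ∧ (Literature.AlgebraicGeometry.Resolution.locAtCentre A₁.toSubring O).comap ι = R n ∧ ∃ e : R n ≃+* Localization.AtPrime (Ideal.comap (Subring.inclusion h₁) (IsLocalRing.maximalIdeal O)), ∀ (z : R n) (hz : ι z ∈ A₁.toSubring), e z = algebraMap A₁.toSubring (Localization.AtPrime (Ideal.comap (Subring.inclusion h₁) (IsLocalRing.maximalIdeal O))) ⟨ι z, hz⟩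 := by
  intro k K K' _ _ _ _ ι O A₀ h₀ hfg hA₀ R h0 hstep n
  -- the pulled-back base lies in the pulled-back valuation ring
  have h₀' : A₀.toSubring.comap ι ≤ (O.comap ι).toSubring := comap_le_comap_valuationSubring ι h₀
  -- `R n = (A₀'[t'])_𝔪'` for a finite `t' ⊆ O'`
  obtain ⟨t', ht', hRn⟩ := exists_eq_locAtCentre_closure_of_sequence h₀' h0 hstep n
  -- the model `A₁ = A₀[ι t']` in `K`
  let t : Finset K := t'.map ⟨ι, ι.injective⟩
  have htc : (↑t : Set K) = ι '' ↑t' := Finset.coe_map _ _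
  have e : Subring.closure ((A₀ : Set K) ∪ ↑t) =
      (Algebra.adjoin k ((A₀ : Set K) ∪ ↑t)).toSubring :=
    closure_subalgebra_union_eq A₀ (↑t : Set K)
  set A₁ : Subalgebra k K := Algebra.adjoin k ((A₀ : Set K) ∪ ↑t) with hA₁_def
  have hA₁ : A₁.toSubring = Subring.closure ((A₀.toSubring : Set K) ∪ ι '' ↑t') := by
    rw [← htc]; exact e.symm
  -- (e) `A₁ ⊆ O`
  have h₁ : A₁.toSubring ≤ O.toSubring := by
    rw [hA₁]; exact closure_union_image_le_valuationSubring ι O h₀ ht'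
  -- (d) `A₁ ≤ range ι`
  have hd : A₁.toSubring ≤ ι.range := by
    rw [hA₁]; exact closure_union_image_le_range ι hA₀ _
  -- (g) the pull-back of the local ring of `A₁` at the centre is `R n`
  have hg : (locAtCentre A₁.toSubring O).comap ι = R n := by
    rw [comap_locAtCentre ι O hd, hRn, hA₁, comap_closure_union_image ι hA₀]
  refine ⟨A₁, h₁, fun x hx => Algebra.subset_adjoin (Or.inl hx), fg_adjoin_subalgebra_union A₀ hfg t,
    hd, hg, exists_ringEquiv_atPrime ι O A₁.toSubring h₁ hd hg⟩

end model

end Summit.ResolutionOfSingularities.ResolutionOfSingularities.Theorems.PfaffLine
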